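import Mathlib
import Literature.MathematicalPhysics.QuantumFieldTheory.YangMillsOS
import Literature.MathematicalPhysics.QuantumFieldTheory.SpeciesLatticeProducts
import Literature.MathematicalPhysics.QuantumFieldTheory.LatticeGaugeProofs
import Literature.MathematicalPhysics.QuantumLattice.WilsonFeynmanHellmann
import HarnessLib

/-!
# Line `Sketch` (holomorphic coupling response) of crux `HypercubicLimit` — stub 2.1:
# fluctuation–response at `t = 0` for the smeared curvature field

Support file for crux `stmt-QuantumFields-16154` (`CoincidenceRotationBootstrap.HypercubicLimit` =
`MirrorModularBoosts.WeakCouplingHypercubicLimit`), line `Sketch` (card `holomorphic-coupling-response`),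
registered stub `stub_fluctuationResponse` of `Cruxes/HypercubicLimit/Lines/Sketch.lean`.

With `μ_k = wilsonMeasure r.ρ (sch.β k)` the Wilson measure of the scheme at step `k` on the torus of side
`sch.side k = 2 L_k + 1` (a probability measure, `isProbabilityMeasure_wilsonMeasure`) and
`Φ_k(f) U = smearedLatticeField r.curvature.F (box 4 L_k) a_k c_k m_k f (torusLift (sch.side k) U)` the
smeared renormalised curvature field (bounded and measurable in the torus configuration), the expectation
of `Φ_k(f₀)` under the tilted measure `μ_k.tilted (t Φ_k(f₁))` (Wilson's theory with the coupling
modulated by `t f₁`) has derivative `Cov_{μ_k}(Φ_k(f₀), Φ_k(f₁))` at `t = 0`.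

Proof: one application of the tree's fluctuation–response identity for exponential tilting,
`hasDerivAt_integral_tilted_eq_covariance` (B. Simon, *The Statistical Mechanics of Lattice Gases* I,
§II.1), at `t = 0` — the tilting variable is bounded on a probability space, so its
exponential-integrability interval is all of `ℝ` (`integrableExpSet_eq_univ_of_abs_le`) — followed by
`μ.tilted (0 · X) = μ.tilted 0 = μ` (`tilted_const`).

* `hasDerivAt_integral_tilted_zero_of_abs_le` — the abstract statement on a probability space
  (private helper);
* `stub_fluctuationResponse` — the registered stub (tree vocabulary).
-/

noncomputable section

open scoped SchwartzMap
open MeasureTheory ProbabilityTheory Filter Topology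
open Literature.MathematicalPhysics.QuantumLattice Literature.MathematicalPhysics.QuantumFieldTheory

namespace Summit.QuantumFields.YangMills.Cruxes.HypercubicLimit.CouplingResponse

/-- **Fluctuation–response at `t = 0`** (abstract form): on a probability space, for a bounded
measurable observable `F` and a bounded measurable tilting variable `X`, the real function
`t ↦ ∫ F d(μ.tilted (t X))` has derivative `Cov_μ(F, X)` at `0` (`hasDerivAt_integral_tilted_eq_covariance`
at `t = 0`, where `integrableExpSet X μ = ℝ` because `X` is bounded, and `μ.tilted 0 = μ`). Feynman–Hellmann / fluctuation–response for Gibbs reweightings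
(B. Simon, The Statistical Mechanics of Lattice Gases I, Princeton 1993, §II.1). [folklore] -/
private theorem hasDerivAt_integral_tilted_zero_of_abs_le {Ω : Type*} {mΩ : MeasurableSpace Ω}
    {μ : Measure Ω} [IsProbabilityMeasure μ] {F X : Ω → ℝ} (hF : Measurable F) (hX : Measurable X)
    {C B : ℝ} (hC : ∀ ω, |F ω| ≤ C) (hB : ∀ ω, |X ω| ≤ B) :
    HasDerivAt (fun t : ℝ => ∫ ω, F ω ∂(μ.tilted (t * X ·))) (cov[F, X; μ]) 0 := by
  have h0 : (0 : ℝ) ∈ interior (integrableExpSet X μ) := by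
    rw [integrableExpSet_eq_univ_of_abs_le hX.aemeasurable (ae_of_all _ hB), interior_univ]
    exact Set.mem_univ _
  have h := hasDerivAt_integral_tilted_eq_covariance (μ := μ) (X := X) (F := F) (C := C) h0
    hF.aestronglyMeasurable (ae_of_all _ fun ω => by rw [Real.norm_eq_abs]; exact hC ω)
  have htilt : μ.tilted (fun ω => (0 : ℝ) * X ω) = μ := by
    simp only [zero_mul]
    exact tilted_const μ 0
  rwa [htilt] at h

/-- **Stub 2.1 of line `Sketch` — fluctuation–response (exact, finite `k`).**  The derivative at `0` of
the expectation of the smeared renormalised curvature field `Φ_k(f₀)` under the Wilson measure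
`μ_k = wilsonMeasure r.ρ (sch.β k)` tilted by `t Φ_k(f₁)` (= Wilson's theory with coupling modulated by
`t f₁`) is the covariance `Cov_{μ_k}(Φ_k(f₀), Φ_k(f₁))` — the truncated lattice two-point function on
`f₀ ⊗ f₁`.  One application of `hasDerivAt_integral_tilted_eq_covariance` at `t = 0`: `μ_k` is a
probability measure (`isProbabilityMeasure_wilsonMeasure`), `Φ_k(f)` is measurable
(`measurable_smearedLatticeField_torusLift`) and bounded (`exists_bound_smearedLatticeField`, the
curvature species being a bounded observable), so `integrableExpSet = univ`. Feynman–Hellmann /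
fluctuation–response for Gibbs reweightings (B. Simon, The Statistical Mechanics of Lattice Gases I,
Princeton 1993, §II.1; lattice gauge setting E. Seiler, LNP 159 (1982), Ch. 1–2). [folklore] -/
theorem stub_fluctuationResponse :
    ∀ (G : Type) [Group G] [TopologicalSpace G] [IsTopologicalGroup G] [CompactSpace G]
      [MeasurableSpace G] [BorelSpace G] (r : LatticeRep G) (sch : SpeciesScheme (YMSpecies G))
      (k : ℕ) (f₀ f₁ : 𝓢(EuclideanSpace ℝ (Fin 4), ℝ)),
      HasDerivAt
        (fun t : ℝ => ∫ U, smearedLatticeField r.curvature.F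
            (Literature.Probability.LatticeModels.box 4 (sch.L k)) (sch.a k) (sch.c r.curvature k)
            (sch.m r.curvature k) f₀ (torusLift (sch.side k) U)
          ∂((wilsonMeasure r.ρ (sch.β k) : Measure (GaugeConfig 4 (sch.side k) G)).tilted
            (fun U => t * smearedLatticeField r.curvature.F
              (Literature.Probability.LatticeModels.box 4 (sch.L k)) (sch.a k) (sch.c r.curvature k)
              (sch.m r.curvature k) f₁ (torusLift (sch.side k) U))))
        (covariance
          (fun U => smearedLatticeField r.curvature.F
            (Literature.Probability.LatticeModels.box 4 (sch.L k)) (sch.a k) (sch.c r.curvature k)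
            (sch.m r.curvature k) f₀ (torusLift (sch.side k) U))
          (fun U => smearedLatticeField r.curvature.F
            (Literature.Probability.LatticeModels.box 4 (sch.L k)) (sch.a k) (sch.c r.curvature k)
            (sch.m r.curvature k) f₁ (torusLift (sch.side k) U))
          (wilsonMeasure r.ρ (sch.β k) : Measure (GaugeConfig 4 (sch.side k) G)))
        0 := by
  intro G _ _ _ _ _ _ r sch k f₀ f₁
  haveI : IsProbabilityMeasure (wilsonMeasure (d := 4) (L := sch.side k) (G := G) r.ρ (sch.β k)) :=
    isProbabilityMeasure_wilsonMeasure r.ρ r.continuous (sch.β k)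
  obtain ⟨C, hC⟩ := exists_bound_smearedLatticeField r.curvature.bounded
    (Literature.Probability.LatticeModels.box 4 (sch.L k)) (sch.a k) (sch.c r.curvature k)
    (sch.m r.curvature k) f₀
  obtain ⟨B, hB⟩ := exists_bound_smearedLatticeField r.curvature.bounded
    (Literature.Probability.LatticeModels.box 4 (sch.L k)) (sch.a k) (sch.c r.curvature k)
    (sch.m r.curvature k) f₁
  exact hasDerivAt_integral_tilted_zero_of_abs_le
    (measurable_smearedLatticeField_torusLift r.curvature _ _ _ _ f₀ (sch.side k))
    (measurable_smearedLatticeField_torusLift r.curvature _ _ _ _ f₁ (sch.side k))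
    (fun U => hC _) (fun U => hB _)

end Summit.QuantumFields.YangMills.Cruxes.HypercubicLimit.CouplingResponse

end
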